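import Literature.Probability.LatticeModels.TorusFourierWienerBound
import HarnessLib

/-!
# A first-MOMENT `ℓ¹` bound for the discrete Fourier transform on `(ℤ/Lℤ)²` from differences of orders one to three, at a scale `R`

Topic `Probability/LatticeModels`; companion of `TorusFourierWienerBound` (`L⁻² Σ_z ‖ĝ(z)‖ ≤ 6√(S₀² + L²D₁²/8 + L⁴D₂²/256)` from the sup and
the first/second differences).  Here the FIRST MOMENT in one lattice direction `j`, for a function living at length scale `R ≥ 1` (an integer):
if `‖Δ_j g‖ ≤ D₁`, `‖Δ_j Δ_i g‖ ≤ D₂` (`i = 0, 1`) and `‖Δ_j Δ₀ Δ₁ g‖ ≤ D₃` pointwise, then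

  `L⁻² Σ_z |z̃_j| ‖ĝ(z)‖ ≤ 6R · √(L²D₁²/16 + L⁴D₂²/(128 R²) + L⁶D₃²/(4096 R⁴))`   (**`sum_abs_valMinAbs_mul_norm_torusFourier_le`**)

(`z̃` the centred representative).  NO sup hypothesis enters (the `z = 0` term carries the factor `|z̃_j| = 0`): for the samples
`g(q) = K(2πq/L)` of a `C³` function with `‖DK‖ ≤ ℓ`, `‖D²K‖ ≤ D`, `‖D³K‖ ≤ E` the bound is `≤ 6R(πℓ/2 + π²D/(2√2 R) + π³E/(8R²))` — for a
function of height `h` varying on the momentum scale `1/R` (`ℓ ≍ hR`, `D ≍ hR²`, `E ≍ hR³`) this is `≍ hR²`, the scale-covariant size of the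
first moment of its position kernel, uniformly in `L`.  Proof: Cauchy–Schwarz against the scaled separable weight
`W_R(z) = (1 + (z̃₀/R)²)(1 + (z̃₁/R)²)` (`Σ_z W_R⁻¹ ≤ 36R²`, from `Σ_{x ∈ ℤ/L} (1 + (x̃/R)²)⁻¹ ≤ 6R`), the factor `z̃_j²·W_R(z)` being a sum of
squared character factors `|χ_z(e_i) − 1|² ≥ (4z̃_i/L)²` of orders one to three (shift theorem), then Plancherel.

* `sum_range_inv_one_add_div_sq_le` (`Σ_{n ≤ N} (1 + (n/R)²)⁻¹ ≤ 2R + 1`), `sum_inv_one_add_valMinAbs_div_sq_le` (`≤ 6R` on `ℤ/L`);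
* `torusFourier_diff₃` — the transform of the third mixed difference;
* **`sum_abs_valMinAbs_mul_norm_torusFourier_le`**.

Everything is proved; no definitions, no named facts.

## Sources

S. Friedli, Y. Velenik, *Statistical Mechanics of Lattice Systems*, CUP 2017, §10.4 (discrete Fourier analysis on the torus)
[`FriedliVelenik2017`]; the weighted (Bernstein-type) embedding is classical (Katznelson, *Harmonic Analysis*, Ch. I §6).
-/

noncomputable section

namespace Literature.Probability.LatticeModels

open Finset Complex
open scoped ComplexConjugate Real

variable {L : ℕ} [NeZero L]

/-! ### §1 The scaled one-dimensional weight sum `Σ (1 + (x̃/R)²)⁻¹ ≤ 6R` -/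

/-- `Σ_{n ≤ N} (1 + (n/R)²)⁻¹ ≤ 2R + 1 − R²/N` for `N ≥ R ≥ 1` (the terms `n ≤ R` are `≤ 1`; beyond, `R²/(R² + n²) ≤ R²/((n−1)n)` telescopes).
[cite: FriedliVelenik2017, §10.4] -/
theorem sum_range_inv_one_add_div_sq_le_sub {R : ℕ} (hR : 1 ≤ R) :
    ∀ N : ℕ, R ≤ N → ∑ n ∈ range (N + 1), (1 : ℝ) / (1 + ((n : ℝ) / R) ^ 2) ≤ 2 * (R : ℝ) + 1 - (R : ℝ) ^ 2 / (N : ℝ) := by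
  have hR0 : (0 : ℝ) < R := by exact_mod_cast hR
  refine Nat.le_induction ?_ ?_
  · -- base `N = R`: `R + 1` terms, each `≤ 1`
    have h : ∑ n ∈ range (R + 1), (1 : ℝ) / (1 + ((n : ℝ) / R) ^ 2) ≤ ∑ _n ∈ range (R + 1), (1 : ℝ) :=
      sum_le_sum fun n _ => by
        rw [div_le_one (by positivity)]
        nlinarith [sq_nonneg ((n : ℝ) / R)]
    rw [sum_const, card_range, nsmul_eq_mul, mul_one] at h
    push_cast at h
    have : (R : ℝ) ^ 2 / (R : ℝ) = R := by rw [sq, mul_div_assoc, div_self hR0.ne', mul_one]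
    linarith
  · intro N hRN ih
    rw [sum_range_succ]
    have hN : (0 : ℝ) < N := by exact_mod_cast lt_of_lt_of_le (by omega : 0 < R) hRN
    have hN1 : (0 : ℝ) < (N : ℝ) + 1 := by positivity
    -- the new term: `1/(1 + ((N+1)/R)²) = R²/(R² + (N+1)²) ≤ R²/(N(N+1)) = R²/N − R²/(N+1)`
    have hterm : (1 : ℝ) / (1 + (((N : ℝ) + 1) / R) ^ 2) ≤ (R : ℝ) ^ 2 / (N : ℝ) - (R : ℝ) ^ 2 / ((N : ℝ) + 1) := by
      rw [show (R : ℝ) ^ 2 / (N : ℝ) - (R : ℝ) ^ 2 / ((N : ℝ) + 1) = (R : ℝ) ^ 2 / ((N : ℝ) * ((N : ℝ) + 1)) by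
        field_simp; ring]
      rw [div_le_div_iff₀ (by positivity) (by positivity)]
      have h2 : (R : ℝ) ^ 2 * (1 + (((N : ℝ) + 1) / R) ^ 2) = (R : ℝ) ^ 2 + ((N : ℝ) + 1) ^ 2 := by
        field_simp
      rw [h2]
      nlinarith [sq_nonneg (R : ℝ)]
    have hcast : (((N + 1 : ℕ) : ℝ)) = (N : ℝ) + 1 := by push_cast; ring
    rw [hcast]
    linarith

/-- `Σ_{n ≤ N} (1 + (n/R)²)⁻¹ ≤ 2R + 1` for every `N` (`R ≥ 1`). [cite: FriedliVelenik2017, §10.4] -/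
theorem sum_range_inv_one_add_div_sq_le {R : ℕ} (hR : 1 ≤ R) (N : ℕ) :
    ∑ n ∈ range (N + 1), (1 : ℝ) / (1 + ((n : ℝ) / R) ^ 2) ≤ 2 * (R : ℝ) + 1 := by
  by_cases h : R ≤ N
  · have h1 := sum_range_inv_one_add_div_sq_le_sub hR N h
    have : 0 ≤ (R : ℝ) ^ 2 / (N : ℝ) := by positivity
    linarith
  · -- `N < R`: at most `N + 1 ≤ R` terms, each `≤ 1`
    have hle : ∑ n ∈ range (N + 1), (1 : ℝ) / (1 + ((n : ℝ) / R) ^ 2) ≤ ∑ _n ∈ range (N + 1), (1 : ℝ) :=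
      sum_le_sum fun n _ => by
        rw [div_le_one (by positivity)]
        nlinarith [sq_nonneg ((n : ℝ) / R)]
    rw [sum_const, card_range, nsmul_eq_mul, mul_one] at hle
    have : ((N + 1 : ℕ) : ℝ) ≤ (R : ℝ) := by exact_mod_cast (by omega : N + 1 ≤ R)
    linarith

/-- **`Σ_{x ∈ ℤ/Lℤ} (1 + (x̃/R)²)⁻¹ ≤ 6R`** (`x̃ = valMinAbs x`, `R ≥ 1`; `x ↦ |x̃|` is at most two-to-one into `ℕ`). [cite: FriedliVelenik2017, §10.4] -/
theorem sum_inv_one_add_valMinAbs_div_sq_le {R : ℕ} (hR : 1 ≤ R) :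
    ∑ x : ZMod L, (1 : ℝ) / (1 + (((x.valMinAbs : ℝ)) / R) ^ 2) ≤ 6 * (R : ℝ) := by
  have hval : ∀ x : ZMod L, (1 : ℝ) / (1 + (((x.valMinAbs : ℝ)) / R) ^ 2) =
      (1 : ℝ) / (1 + (((x.valMinAbs.natAbs : ℕ) : ℝ) / R) ^ 2) := by
    intro x
    rw [← Int.cast_natCast (R := ℝ) x.valMinAbs.natAbs, Int.natCast_natAbs, Int.cast_abs, div_pow, div_pow, sq_abs]
  -- fibres of `x ↦ |x̃|` have at most two elements
  have hc1 : ∀ m : ℤ, ((univ : Finset (ZMod L)).filter fun x => x.valMinAbs = m).card ≤ 1 := by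
    intro m
    refine card_le_one.2 fun x hx y hy => ?_
    rw [mem_filter] at hx hy
    exact ZMod.injective_valMinAbs (hx.2.trans hy.2.symm)
  have hfib : ∀ n : ℕ, ((univ : Finset (ZMod L)).filter fun x => x.valMinAbs.natAbs = n).card ≤ 2 := by
    intro n
    have hsub : ((univ : Finset (ZMod L)).filter fun x => x.valMinAbs.natAbs = n) ⊆
        ((univ : Finset (ZMod L)).filter fun x => x.valMinAbs = (n : ℤ)) ∪
          ((univ : Finset (ZMod L)).filter fun x => x.valMinAbs = -(n : ℤ)) := by
      intro x hx
      rw [mem_filter] at hx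
      rw [mem_union, mem_filter, mem_filter]
      have h := Int.natAbs_eq x.valMinAbs
      rw [hx.2] at h
      rcases h with h' | h'
      · exact Or.inl ⟨mem_univ _, h'⟩
      · exact Or.inr ⟨mem_univ _, h'⟩
    exact (card_le_card hsub).trans ((card_union_le _ _).trans (add_le_add (hc1 _) (hc1 _)))
  have hN : ∀ x ∈ (univ : Finset (ZMod L)), x.valMinAbs.natAbs ∈ range (L + 1) := by
    intro x _
    rw [mem_range]
    have := ZMod.natAbs_valMinAbs_le x
    omega
  rw [Finset.sum_congr rfl fun x (_ : x ∈ (univ : Finset (ZMod L))) => hval x, ← sum_fiberwise_of_maps_to hN]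
  have hinner : ∀ n ∈ range (L + 1),
      ∑ x ∈ univ.filter (fun x : ZMod L => x.valMinAbs.natAbs = n), (1 : ℝ) / (1 + (((x.valMinAbs.natAbs : ℕ) : ℝ) / R) ^ 2) ≤
        2 * (1 / (1 + ((n : ℝ) / R) ^ 2)) := by
    intro n _
    rw [sum_congr rfl fun x hx => by rw [(mem_filter.1 hx).2], sum_const, nsmul_eq_mul]
    refine mul_le_mul_of_nonneg_right ?_ (by positivity)
    exact_mod_cast hfib n
  calc _ ≤ ∑ n ∈ range (L + 1), 2 * (1 / (1 + ((n : ℝ) / R) ^ 2)) := sum_le_sum hinner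
    _ = 2 * ∑ n ∈ range (L + 1), 1 / (1 + ((n : ℝ) / R) ^ 2) := by rw [mul_sum]
    _ ≤ 2 * (2 * (R : ℝ) + 1) := by linarith [sum_range_inv_one_add_div_sq_le hR L]
    _ ≤ 6 * (R : ℝ) := by
        have : (1 : ℝ) ≤ R := by exact_mod_cast hR
        linarith

/-! ### §2 The transform of a third mixed difference -/

/-- The transform of the third mixed difference along `e, e', e''`:
`(Δ_{e''}Δ_{e'}Δ_e g)^(z) = (χ_z(e'') − 1)(χ_z(e') − 1)(χ_z(e) − 1)·ĝ(z)`. [cite: FriedliVelenik2017, §10.4] -/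
theorem torusFourier_diff₃ {d : ℕ} (g : TorusSite d L → ℂ) (e e' e'' z : TorusSite d L) :
    torusFourier (fun x => (g (x + e + e' + e'') - g (x + e + e'') - g (x + e' + e'') + g (x + e'')) -
        (g (x + e + e') - g (x + e) - g (x + e') + g x)) z =
      (torusChar z e'' - 1) * ((torusChar z e' - 1) * (torusChar z e - 1) * torusFourier g z) := by
  set g2 : TorusSite d L → ℂ := fun x => g (x + e + e') - g (x + e) - g (x + e') + g x with hg2
  have h1 : (fun x => (g (x + e + e' + e'') - g (x + e + e'') - g (x + e' + e'') + g (x + e'')) -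
      (g (x + e + e') - g (x + e) - g (x + e') + g x)) = fun x => g2 (x + e'') - g2 x := by
    funext x
    simp only [hg2, add_right_comm _ e'' e, add_right_comm _ e'' e']
  rw [h1, torusFourier_diff g2 e'' z, torusFourier_diff_diff g e e' z]

/-! ### §3 The first-moment bound -/

set_option maxHeartbeats 400000 in
/-- **First-moment `ℓ¹` bound on `(ℤ/Lℤ)²` at scale `R`**: if `‖Δ_j g‖ ≤ D₁`, `‖Δ_jΔ_i g‖ ≤ D₂` for `i = 0, 1` and `‖Δ_jΔ₀Δ₁ g‖ ≤ D₃`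
(pointwise forward differences along the unit steps `e_i = Pi.single i 1`), then for every integer `R ≥ 1`
`L⁻² Σ_z |z̃_j| ‖ĝ(z)‖ ≤ 6R · √(L²D₁²/16 + L⁴D₂²/(128R²) + L⁶D₃²/(4096R⁴))`. [cite: FriedliVelenik2017, §10.4] -/
theorem sum_abs_valMinAbs_mul_norm_torusFourier_le (g : TorusSite 2 L → ℂ) (j : Fin 2) {R : ℕ} (hR : 1 ≤ R) {D₁ D₂ D₃ : ℝ}
    (h1 : ∀ x : TorusSite 2 L, ‖g (x + Pi.single j 1) - g x‖ ≤ D₁)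
    (h2 : ∀ (i : Fin 2) (x : TorusSite 2 L),
      ‖g (x + Pi.single j 1 + Pi.single i 1) - g (x + Pi.single j 1) - g (x + Pi.single i 1) + g x‖ ≤ D₂)
    (h3 : ∀ x : TorusSite 2 L,
      ‖(g (x + Pi.single j 1 + Pi.single 0 1 + Pi.single 1 1) - g (x + Pi.single j 1 + Pi.single 1 1) -
          g (x + Pi.single 0 1 + Pi.single 1 1) + g (x + Pi.single 1 1)) -
        (g (x + Pi.single j 1 + Pi.single 0 1) - g (x + Pi.single j 1) - g (x + Pi.single 0 1) + g x)‖ ≤ D₃) :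
    ((L : ℝ) ^ 2)⁻¹ * ∑ z : TorusSite 2 L, |((z j).valMinAbs : ℝ)| * ‖torusFourier g z‖ ≤
      6 * (R : ℝ) * Real.sqrt ((L : ℝ) ^ 2 / 16 * D₁ ^ 2 + (L : ℝ) ^ 4 / (128 * (R : ℝ) ^ 2) * D₂ ^ 2 +
        (L : ℝ) ^ 6 / (4096 * (R : ℝ) ^ 4) * D₃ ^ 2) := by
  have hL : (0 : ℝ) < L := Nat.cast_pos.2 (Nat.pos_of_ne_zero (NeZero.ne L))
  have hR0 : (0 : ℝ) < R := by exact_mod_cast hR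
  -- the weight
  set m : TorusSite 2 L → Fin 2 → ℝ := fun z i => (((z i).valMinAbs : ℤ) : ℝ) with hm
  set W : TorusSite 2 L → ℝ := fun z => (1 + (m z 0 / R) ^ 2) * (1 + (m z 1 / R) ^ 2) with hW
  have hWpos : ∀ z, 0 < W z := fun z => by rw [hW]; positivity
  -- (1) `Σ 1/W ≤ 36 R²`
  have h1D := sum_inv_one_add_valMinAbs_div_sq_le (L := L) hR
  have h1D0 : 0 ≤ ∑ x : ZMod L, (1 : ℝ) / (1 + (((x.valMinAbs : ℝ)) / R) ^ 2) := sum_nonneg fun x _ => by positivity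
  have hWsum : ∑ z : TorusSite 2 L, 1 / W z ≤ 36 * (R : ℝ) ^ 2 := by
    have hprod : ∑ z : TorusSite 2 L, 1 / W z =
        ∏ i : Fin 2, ∑ x : ZMod L, (1 : ℝ) / (1 + (((x.valMinAbs : ℝ)) / R) ^ 2) := by
      rw [Finset.prod_univ_sum]
      simp only [Fintype.piFinset_univ]
      refine sum_congr rfl fun z _ => ?_
      rw [Fin.prod_univ_two, hW, hm]
      dsimp only
      rw [one_div_mul_one_div]
    rw [hprod, Fin.prod_univ_two]
    nlinarith
  -- (2) the differences and their transforms
  set ej : TorusSite 2 L := Pi.single j 1 with hej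
  set e0 : TorusSite 2 L := Pi.single 0 1 with he0
  set e1 : TorusSite 2 L := Pi.single 1 1 with he1
  set gj : TorusSite 2 L → ℂ := fun x => g (x + ej) - g x with hgj
  set gj0 : TorusSite 2 L → ℂ := fun x => g (x + ej + e0) - g (x + ej) - g (x + e0) + g x with hgj0
  set gj1 : TorusSite 2 L → ℂ := fun x => g (x + ej + e1) - g (x + ej) - g (x + e1) + g x with hgj1
  set gj01 : TorusSite 2 L → ℂ := fun x => (g (x + ej + e0 + e1) - g (x + ej + e1) - g (x + e0 + e1) + g (x + e1)) -
    (g (x + ej + e0) - g (x + ej) - g (x + e0) + g x) with hgj01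
  have hFj : ∀ z, torusFourier gj z = (torusChar z ej - 1) * torusFourier g z := fun z => torusFourier_diff g ej z
  have hFj0 : ∀ z, torusFourier gj0 z = (torusChar z e0 - 1) * (torusChar z ej - 1) * torusFourier g z :=
    fun z => torusFourier_diff_diff g ej e0 z
  have hFj1 : ∀ z, torusFourier gj1 z = (torusChar z e1 - 1) * (torusChar z ej - 1) * torusFourier g z :=
    fun z => torusFourier_diff_diff g ej e1 z
  have hFj01 : ∀ z, torusFourier gj01 z = (torusChar z e1 - 1) * ((torusChar z e0 - 1) * (torusChar z ej - 1) * torusFourier g z) :=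
    fun z => torusFourier_diff₃ g ej e0 e1 z
  have hmi : ∀ z (i : Fin 2), m z i ^ 2 ≤ (L : ℝ) ^ 2 / 16 * ‖torusChar z (Pi.single i 1) - 1‖ ^ 2 := by
    intro z i
    have h := four_mul_abs_valMinAbs_div_le_norm_torusChar_single_sub_one z i
    have h' : 4 * |m z i| ≤ (L : ℝ) * ‖torusChar z (Pi.single i 1) - 1‖ := by
      rw [hm]; dsimp only
      rw [div_le_iff₀ hL] at h
      linarith
    have h'' := pow_le_pow_left₀ (by positivity) h' 2
    rw [mul_pow, mul_pow, sq_abs] at h''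
    nlinarith
  -- (2') the pointwise weighted bound: `m_j² W(z) ‖ĝ‖² ≤ (L²/16)‖ĝj‖² + (L⁴/256R²)(‖ĝj0‖² + ‖ĝj1‖²) + (L⁶/4096R⁴)‖ĝj01‖²`
  have hpt : ∀ z, W z * (m z j ^ 2 * ‖torusFourier g z‖ ^ 2) ≤
      (L : ℝ) ^ 2 / 16 * ‖torusFourier gj z‖ ^ 2 +
        (L : ℝ) ^ 4 / (256 * (R : ℝ) ^ 2) * (‖torusFourier gj0 z‖ ^ 2 + ‖torusFourier gj1 z‖ ^ 2) +
          (L : ℝ) ^ 6 / (4096 * (R : ℝ) ^ 4) * ‖torusFourier gj01 z‖ ^ 2 := by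
    intro z
    rw [hFj, hFj0, hFj1, hFj01]
    simp only [norm_mul, mul_pow]
    have hmj' := hmi z j
    have hm0 := hmi z 0
    have hm1 := hmi z 1
    rw [← hej] at hmj'
    rw [← he0] at hm0
    rw [← he1] at hm1
    set A := ‖torusFourier g z‖ ^ 2
    set aj := ‖torusChar z ej - 1‖ ^ 2
    set a0 := ‖torusChar z e0 - 1‖ ^ 2
    set a1 := ‖torusChar z e1 - 1‖ ^ 2
    have hA : 0 ≤ A := by positivity
    have haj : 0 ≤ aj := by positivity
    have ha0 : 0 ≤ a0 := by positivity
    have ha1 : 0 ≤ a1 := by positivity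
    have hmjj : 0 ≤ m z j ^ 2 := sq_nonneg _
    have hm00 : 0 ≤ m z 0 ^ 2 := sq_nonneg _
    have hm11 : 0 ≤ m z 1 ^ 2 := sq_nonneg _
    rw [hW]
    dsimp only
    -- expand the weight: `W·m_j² = m_j² + m_j²m_0²/R² + m_j²m_1²/R² + m_j²m_0²m_1²/R⁴`
    have hR2 : (0 : ℝ) < (R : ℝ) ^ 2 := by positivity
    have hR4 : (0 : ℝ) < (R : ℝ) ^ 4 := by positivity
    have hT1 : m z j ^ 2 * A ≤ (L : ℝ) ^ 2 / 16 * (aj * A) := by nlinarith [mul_le_mul_of_nonneg_right hmj' hA]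
    have hT2 : m z j ^ 2 * m z 0 ^ 2 * A ≤ (L : ℝ) ^ 4 / 256 * (a0 * aj * A) := by
      have := mul_le_mul hmj' hm0 hm00 (by positivity)
      nlinarith [mul_le_mul_of_nonneg_right this hA]
    have hT3 : m z j ^ 2 * m z 1 ^ 2 * A ≤ (L : ℝ) ^ 4 / 256 * (a1 * aj * A) := by
      have := mul_le_mul hmj' hm1 hm11 (by positivity)
      nlinarith [mul_le_mul_of_nonneg_right this hA]
    have hT4 : m z j ^ 2 * m z 0 ^ 2 * m z 1 ^ 2 * A ≤ (L : ℝ) ^ 6 / 4096 * (a1 * (a0 * aj * A)) := by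
      have h01 := mul_le_mul hmj' hm0 hm00 (by positivity)
      have h012 := mul_le_mul h01 hm1 hm11 (by positivity)
      nlinarith [mul_le_mul_of_nonneg_right h012 hA]
    have hexp : (1 + (m z 0 / R) ^ 2) * (1 + (m z 1 / R) ^ 2) * (m z j ^ 2 * A) =
        m z j ^ 2 * A + (m z j ^ 2 * m z 0 ^ 2 * A) / (R : ℝ) ^ 2 + (m z j ^ 2 * m z 1 ^ 2 * A) / (R : ℝ) ^ 2 +
          (m z j ^ 2 * m z 0 ^ 2 * m z 1 ^ 2 * A) / (R : ℝ) ^ 4 := by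
      field_simp
      ring
    rw [hexp]
    have hT2' : (m z j ^ 2 * m z 0 ^ 2 * A) / (R : ℝ) ^ 2 ≤ (L : ℝ) ^ 4 / (256 * (R : ℝ) ^ 2) * (a0 * aj * A) := by
      rw [div_le_iff₀ hR2]; rw [show (L : ℝ) ^ 4 / (256 * (R : ℝ) ^ 2) * (a0 * aj * A) * (R : ℝ) ^ 2 =
        (L : ℝ) ^ 4 / 256 * (a0 * aj * A) by field_simp]; exact hT2
    have hT3' : (m z j ^ 2 * m z 1 ^ 2 * A) / (R : ℝ) ^ 2 ≤ (L : ℝ) ^ 4 / (256 * (R : ℝ) ^ 2) * (a1 * aj * A) := by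
      rw [div_le_iff₀ hR2]; rw [show (L : ℝ) ^ 4 / (256 * (R : ℝ) ^ 2) * (a1 * aj * A) * (R : ℝ) ^ 2 =
        (L : ℝ) ^ 4 / 256 * (a1 * aj * A) by field_simp]; exact hT3
    have hT4' : (m z j ^ 2 * m z 0 ^ 2 * m z 1 ^ 2 * A) / (R : ℝ) ^ 4 ≤ (L : ℝ) ^ 6 / (4096 * (R : ℝ) ^ 4) * (a1 * (a0 * aj * A)) := by
      rw [div_le_iff₀ hR4]; rw [show (L : ℝ) ^ 6 / (4096 * (R : ℝ) ^ 4) * (a1 * (a0 * aj * A)) * (R : ℝ) ^ 4 =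
        (L : ℝ) ^ 6 / 4096 * (a1 * (a0 * aj * A)) by field_simp]; exact hT4
    linarith
  -- (3) sum + Plancherel
  have hDj : ∑ z : TorusSite 2 L, ‖torusFourier gj z‖ ^ 2 ≤ (L : ℝ) ^ 2 * ((L : ℝ) ^ 2 * D₁ ^ 2) :=
    sum_norm_sq_torusFourier_le gj fun x => h1 x
  have hDj0 : ∑ z : TorusSite 2 L, ‖torusFourier gj0 z‖ ^ 2 ≤ (L : ℝ) ^ 2 * ((L : ℝ) ^ 2 * D₂ ^ 2) :=
    sum_norm_sq_torusFourier_le gj0 fun x => h2 0 x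
  have hDj1 : ∑ z : TorusSite 2 L, ‖torusFourier gj1 z‖ ^ 2 ≤ (L : ℝ) ^ 2 * ((L : ℝ) ^ 2 * D₂ ^ 2) :=
    sum_norm_sq_torusFourier_le gj1 fun x => h2 1 x
  have hDj01 : ∑ z : TorusSite 2 L, ‖torusFourier gj01 z‖ ^ 2 ≤ (L : ℝ) ^ 2 * ((L : ℝ) ^ 2 * D₃ ^ 2) :=
    sum_norm_sq_torusFourier_le gj01 fun x => h3 x
  set X : ℝ := (L : ℝ) ^ 2 / 16 * D₁ ^ 2 + (L : ℝ) ^ 4 / (128 * (R : ℝ) ^ 2) * D₂ ^ 2 +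
    (L : ℝ) ^ 6 / (4096 * (R : ℝ) ^ 4) * D₃ ^ 2 with hX
  have hX0 : 0 ≤ X := by positivity
  have hWg : ∑ z : TorusSite 2 L, W z * (m z j ^ 2 * ‖torusFourier g z‖ ^ 2) ≤ (L : ℝ) ^ 4 * X := by
    calc ∑ z : TorusSite 2 L, W z * (m z j ^ 2 * ‖torusFourier g z‖ ^ 2)
        ≤ ∑ z : TorusSite 2 L, ((L : ℝ) ^ 2 / 16 * ‖torusFourier gj z‖ ^ 2 +
            (L : ℝ) ^ 4 / (256 * (R : ℝ) ^ 2) * (‖torusFourier gj0 z‖ ^ 2 + ‖torusFourier gj1 z‖ ^ 2) +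
              (L : ℝ) ^ 6 / (4096 * (R : ℝ) ^ 4) * ‖torusFourier gj01 z‖ ^ 2) := sum_le_sum fun z _ => hpt z
      _ = (L : ℝ) ^ 2 / 16 * ∑ z : TorusSite 2 L, ‖torusFourier gj z‖ ^ 2 +
            (L : ℝ) ^ 4 / (256 * (R : ℝ) ^ 2) * (∑ z : TorusSite 2 L, ‖torusFourier gj0 z‖ ^ 2 + ∑ z : TorusSite 2 L, ‖torusFourier gj1 z‖ ^ 2) +
            (L : ℝ) ^ 6 / (4096 * (R : ℝ) ^ 4) * ∑ z : TorusSite 2 L, ‖torusFourier gj01 z‖ ^ 2 := by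
          rw [sum_add_distrib, sum_add_distrib, ← mul_sum, ← mul_sum, ← mul_sum, sum_add_distrib]
      _ ≤ (L : ℝ) ^ 2 / 16 * ((L : ℝ) ^ 2 * ((L : ℝ) ^ 2 * D₁ ^ 2)) +
            (L : ℝ) ^ 4 / (256 * (R : ℝ) ^ 2) * ((L : ℝ) ^ 2 * ((L : ℝ) ^ 2 * D₂ ^ 2) + (L : ℝ) ^ 2 * ((L : ℝ) ^ 2 * D₂ ^ 2)) +
            (L : ℝ) ^ 6 / (4096 * (R : ℝ) ^ 4) * ((L : ℝ) ^ 2 * ((L : ℝ) ^ 2 * D₃ ^ 2)) := by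
          gcongr
      _ = (L : ℝ) ^ 4 * X := by rw [hX]; field_simp; ring
  -- (4) Cauchy–Schwarz with `r z = |m_j| ‖ĝ z‖`
  have hCS := sum_sq_le_sum_mul_sum_of_sq_le_mul (univ : Finset (TorusSite 2 L))
    (f := fun z => 1 / W z) (g := fun z => W z * (m z j ^ 2 * ‖torusFourier g z‖ ^ 2)) (r := fun z => |m z j| * ‖torusFourier g z‖)
    (fun z _ => by positivity) (fun z _ => by positivity)
    (fun z _ => by rw [one_div, ← mul_assoc, inv_mul_cancel₀ (hWpos z).ne', one_mul, mul_pow, sq_abs])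
  have hsum0 : 0 ≤ ∑ z : TorusSite 2 L, |m z j| * ‖torusFourier g z‖ := sum_nonneg fun z _ => by positivity
  have hsq : (∑ z : TorusSite 2 L, |m z j| * ‖torusFourier g z‖) ^ 2 ≤ (6 * (R : ℝ) * (L : ℝ) ^ 2 * Real.sqrt X) ^ 2 := by
    rw [mul_pow, mul_pow, mul_pow, Real.sq_sqrt hX0]
    calc (∑ z : TorusSite 2 L, |m z j| * ‖torusFourier g z‖) ^ 2
        ≤ (∑ z : TorusSite 2 L, 1 / W z) * ∑ z : TorusSite 2 L, W z * (m z j ^ 2 * ‖torusFourier g z‖ ^ 2) := hCS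
      _ ≤ 36 * (R : ℝ) ^ 2 * ((L : ℝ) ^ 4 * X) :=
          mul_le_mul hWsum hWg (sum_nonneg fun z _ => by positivity) (by positivity)
      _ = _ := by ring
  have hB0 : 0 ≤ 6 * (R : ℝ) * (L : ℝ) ^ 2 * Real.sqrt X := by positivity
  have hle : ∑ z : TorusSite 2 L, |m z j| * ‖torusFourier g z‖ ≤ 6 * (R : ℝ) * (L : ℝ) ^ 2 * Real.sqrt X :=
    (pow_le_pow_iff_left₀ hsum0 hB0 two_ne_zero).1 hsq
  have hmz : ∀ z : TorusSite 2 L, |((z j).valMinAbs : ℝ)| = |m z j| := fun z => by rw [hm]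
  simp_rw [hmz]
  calc ((L : ℝ) ^ 2)⁻¹ * ∑ z : TorusSite 2 L, |m z j| * ‖torusFourier g z‖
      ≤ ((L : ℝ) ^ 2)⁻¹ * (6 * (R : ℝ) * (L : ℝ) ^ 2 * Real.sqrt X) := mul_le_mul_of_nonneg_left hle (by positivity)
    _ = 6 * (R : ℝ) * Real.sqrt X := by field_simp

end Literature.Probability.LatticeModels

end
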